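import Literature.Topology.FourManifolds.CobordismEndClassesTwoComponents
import Literature.Topology.FourManifolds.HCobordismMorseComplexProofs
import Literature.Topology.FourManifolds.HCobordismMorseHomologyFree
import Literature.Topology.FourManifolds.KroneckerFreeCohomology
import Literature.Topology.FourManifolds.HCobordismEvenLevels
import Literature.Topology.FourManifolds.HCobordismLevelConnectivityProofs
import Literature.Topology.FourManifolds.HCobordismMiddleLevelChain
import Literature.Topology.FourManifolds.CobordismEndCorrespondence
import Literature.Topology.FourManifolds.DisjointSpheresSlab
import Literature.Topology.FourManifolds.MorseTurnAbout
import Literature.Topology.FourManifolds.IntersectionLatticeProofs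
import Literature.AlgebraicTopology.SingularHomology.RelativeHomology
import Literature.AlgebraicTopology.SingularHomology.HOneProducts
import HarnessLib

/-!
# Evenness of a closed 4-manifold from an even level above it (homological half of Wall's parity bridge)

This file is the homological half of the proof that a simply connected closed smooth
4-manifold `X` all of whose sphere maps `S² → X` are stably tangent-framed has **even**
intersection form (the parity bridge used in the proof of Wall 1964, Thm. 2,
`Literature.Topology.FourManifolds.isHCobordant_of_equivalent_intersectionForm`; the geometric
half — a nice Morse function on the punctured cylinder `W' : S⁴ ⇝ X ⊔ X` whose middle level
`N = S⁴ # k(S² × S²)` has even form — is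
`Literature.Topology.FourManifolds.exists_level_puncturedCylinder_isEven`).

**Main result** (`Cobordism.IsNiceMorseFunction.isEven_intersectionForm_of_level_half`).  Let
`c : P ⇝ X ⊔ X` be a cobordism of closed smooth 4-manifolds with `P`, `X` simply connected,
`g` a nice Morse function on `c` all of whose critical points have
index `≥ 2`, and suppose the level `g⁻¹(1/2)` (presented by an embedding `e : N → W`) has even
intersection form for every orientation.  Then `Q_X` is even.

**Proof** (Wall 1964, proof of Thm. 2, p. 145, "`h` extends over the added handles"; Milnor 1965,
Thm. 7.4 with Cor. 3.15, and the exact sequence of the pair; Thom's isotropy, Thom 1952 Thm. V.7).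
Let `U = g⁻¹[1/2, a₁]` be the slab above the middle level (`a₁` above all critical values), a
cobordism from `V = g⁻¹(1/2) ≅ N` to `g⁻¹(a₁) ≅ X ⊔ X`; it is simply connected (Milnor, Remark 1
after Thm. 6.4: it is `V` with cells of dimension `≥ 3` attached, and `V` is simply connected
by turning the triad about, `S⁴ = P` being simply connected).  Read from the top, `U` carries a
nice Morse function all of whose critical points have index `5 - λ ≤ 2`; by Milnor's Thm. 7.4
the Morse complex `C⁎` computes `H⁎(U, X ⊔ X)`, so `H₃(U, X ⊔ X) = 0` and
`H₂(U, X ⊔ X) ↪ C₂` is free; by the exact sequence of the pair,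
`H₂(X ⊔ X) → H₂(U)` is injective with free cokernel, so every functional on `H₂(X ⊔ X; ℤ)`
extends to `H₂(U; ℤ)` and (universal coefficients, Hatcher Thm. 3.2) is the restriction of a
class `S ∈ H²(U; ℤ)`.  Choose `S` with periods `⟨S, ι₁_* y⟩ = ⟨α, y⟩`, `⟨S, ι₂_* y⟩ = 0`
(`ι₁, ι₂ : X → X ⊔ X ↪ U`), so that `ι₁^* S ≡ α` and `ι₂^* S ≡ 0` modulo torsion (`X` simply
connected: `H²(X)/T ≅ Hom(H₂(X), ℤ)`).  Thom's isotropy for the relative fundamental class of `U`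
(`∂[U] = ±[V] ± [X]₁ ± [X]₂`) gives `±Q_V(S|V, S|V) ± Q_X(α, α) ± Q_X(0, 0) = 0`, and `Q_V` is
even.  Hence `Q_X(α, α)` is even.

## References

* C. T. C. Wall, *On simply-connected 4-manifolds*, J. London Math. Soc. 39 (1964) 141–149,
  proof of Thm. 2 (p. 145). [WallJLMS1964]
* J. Milnor, *Lectures on the h-cobordism theorem*, Princeton (1965), Thm. 7.4 (PDF p. 48),
  Cor. 3.15, Remark 1 after Thm. 6.4. [MilnorHCobordism1965]
* A. Hatcher, *Algebraic Topology*, CUP (2002), Thm. 2.13 ff. (pair sequence), Thm. 3.2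
  (universal coefficients). [HatcherAT2002]
* R. Thom, *Quelques propriétés globales des variétés différentiables*, Comment. Math. Helv. 28
  (1954), Thm. V.7. [Thom1952]
-/

open scoped Manifold ContDiff Topology
open Set Function CategoryTheory Limits
open Literature.AlgebraicTopology.SingularHomology
open Literature.AlgebraicTopology.SingularHomology.SingularSimplex (sumInl sumInr)

noncomputable section

/-! ### Algebra: extending functionals across a monomorphism with free cokernel -/

/-- Extension of linear functionals across a monomorphism `ι : A → B` whose cokernel (presented as
the image of `π : B → C` with `ι, π` exact) is a free module. [folklore] -/
theorem LinearMap.exists_comp_eq_of_exact_of_free_range {R A B C : Type*} [CommRing R]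
    [AddCommGroup A] [Module R A] [AddCommGroup B] [Module R B] [AddCommGroup C] [Module R C]
    (ι : A →ₗ[R] B) (π : B →ₗ[R] C) (hι : Function.Injective ι) (hex : Function.Exact ι π)
    [Module.Free R (LinearMap.range π)] (φ : A →ₗ[R] R) :
    ∃ ψ : B →ₗ[R] R, ψ ∘ₗ ι = φ := by
  -- a section of `B → range π`
  obtain ⟨s, hs⟩ := Module.projective_lifting_property π.rangeRestrict
    (LinearMap.id : LinearMap.range π →ₗ[R] LinearMap.range π) π.surjective_rangeRestrict
  have hs' : ∀ y, π.rangeRestrict (s y) = y := fun y => by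
    have h := LinearMap.congr_fun hs y
    rw [LinearMap.comp_apply, LinearMap.id_apply] at h
    exact h
  have hπs : ∀ y : LinearMap.range π, π (s y) = (y : C) := fun y => by
    have := congrArg Subtype.val (hs' y)
    exact this
  -- `b - s (π b)` lies in `ker π = range ι`
  have hker : ∀ b : B, ∃ a : A, ι a = b - s (π.rangeRestrict b) := fun b => by
    have hb : π (b - s (π.rangeRestrict b)) = 0 := by
      rw [map_sub, hπs, LinearMap.codRestrict_apply, sub_self]
    exact (hex _).1 hb
  choose r hr using hker
  have hr_lin : IsLinearMap R r := by
    constructor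
    · intro x y
      apply hι
      rw [map_add, hr, hr, hr, map_add, map_add]
      abel
    · intro c x
      apply hι
      rw [map_smul, hr, hr, map_smul, map_smul, smul_sub]
  refine ⟨φ ∘ₗ hr_lin.mk' r, ?_⟩
  ext a
  simp only [LinearMap.comp_apply, IsLinearMap.mk'_apply]
  congr 1
  apply hι
  rw [hr]
  have hπι : π (ι a) = 0 := (hex (ι a)).2 ⟨a, rfl⟩
  have : π.rangeRestrict (ι a) = 0 := by
    ext
    rw [LinearMap.codRestrict_apply, hπι]
    rfl
  rw [this, map_zero, sub_zero]

/-- Extension of linear functionals across a monomorphism `ι : A → B` when `coker ι` embeds (via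
`π` with `ι, π` exact and an injection `j`) into a finitely generated free module over a PID:
then `coker ι` is free (submodules of f.g. free modules over a PID are free) and the previous
lemma applies. [folklore] -/
theorem LinearMap.exists_comp_eq_of_exact_of_injective {R A B C F : Type*} [CommRing R]
    [IsDomain R] [IsPrincipalIdealRing R]
    [AddCommGroup A] [Module R A] [AddCommGroup B] [Module R B] [AddCommGroup C] [Module R C]
    [AddCommGroup F] [Module R F] [Module.Free R F] [Module.Finite R F]
    (ι : A →ₗ[R] B) (π : B →ₗ[R] C) (j : C →ₗ[R] F) (hι : Function.Injective ι)
    (hex : Function.Exact ι π) (hj : Function.Injective j) (φ : A →ₗ[R] R) :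
    ∃ ψ : B →ₗ[R] R, ψ ∘ₗ ι = φ := by
  haveI : Module.Free R (LinearMap.range π) := by
    obtain ⟨m, b⟩ := Submodule.basisOfPid (Module.finBasis R F)
      (Submodule.map j (LinearMap.range π))
    exact Module.Free.of_basis
      (b.map (Submodule.equivMapOfInjective j hj (LinearMap.range π)).symm)
  exact LinearMap.exists_comp_eq_of_exact_of_free_range ι π hι hex φ

namespace Literature.Topology.FourManifolds

universe u

/-! ### Milnor's Thm. 7.4 for index `≤ 2`: classes on the cobordism with prescribed periods on the end -/

section Morse

variable {n : ℕ} {M N : Type u} [TopologicalSpace M] [T2Space M] [SecondCountableTopology M]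
  [ChartedSpace (EuclideanSpace ℝ (Fin n)) M] [IsManifold (𝓡 n) ∞ M] [CompactSpace M]
  [TopologicalSpace N] [T2Space N] [SecondCountableTopology N]
  [ChartedSpace (EuclideanSpace ℝ (Fin n)) N] [IsManifold (𝓡 n) ∞ N] [CompactSpace N]

/-- **Morse homology of a cobordism all of whose critical points have index `≤ 2`** (Milnor
1965, Thm. 7.4 with Cor. 3.15: the Morse complex `C⁎` of a nice Morse function computes
`H⁎(W, V)`, `C_k` free of rank the number of critical points of index `k`): if every critical
point of the nice Morse function `g` has index `≤ 2` then `C₃ = 0`, so `H₃(W, V; ℤ) = 0` and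
`H₂(W, V; ℤ) = ker(C₂ → C₁)` injects into the finitely generated free module `C₂`
(`V = inl(M)`). [cite: MilnorHCobordism1965, Thm. 7.4 (PDF p. 48), Cor. 3.15 (PDF p. 19)] -/
theorem Cobordism.IsNiceMorseFunction.relativeHomology_of_morseIndex_le_two {c : Cobordism n M N}
    {g : c.W → ℝ} (hg : c.IsNiceMorseFunction g)
    (h2 : ∀ z ∈ criticalSet (𝓡∂ (n + 1)) g, morseIndex (𝓡∂ (n + 1)) g z ≤ 2) :
    IsZero (relativeSingularHomology ℤ ℤ c.W (range c.inl) 3) ∧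
      Module.Free ℤ (c.morseHomology g 2 2) ∧ Module.Finite ℤ (c.morseHomology g 2 2) ∧
      ∃ j : relativeSingularHomology ℤ ℤ c.W (range c.inl) 2 →ₗ[ℤ] c.morseHomology g 2 2,
        Function.Injective j := by
  classical
  -- `C₃ = 0`
  obtain ⟨-, hfree3, hfin3, hrank3⟩ := Cobordism.Milnor1965_morseHomology_free_holds hg 3
  have hcrit3 : criticalSetOfIndex (𝓡∂ (n + 1)) g 3 = ∅ := by
    ext z
    simp only [mem_criticalSetOfIndex, mem_empty_iff_false, iff_false, not_and]
    intro hz h3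
    have := h2 z hz
    omega
  haveI := hfree3
  haveI := hfin3
  have hsub3 : Subsingleton (c.morseHomology g 3 3) := by
    rw [hcrit3, ncard_empty] at hrank3
    refine ⟨fun x y => ?_⟩
    have hx : ∀ x : c.morseHomology g 3 3, x = 0 := fun x => by
      obtain ⟨a, ha, hax⟩ := (Module.finrank_eq_zero_iff (R := ℤ)).1 hrank3 x
      exact (smul_eq_zero.1 hax).resolve_left ha
    rw [hx x, hx y]
  have hC3 : IsZero (c.morseHomology g 3 3) := ModuleCat.isZero_of_subsingleton _
  -- `H₃(W, V) = 0`
  obtain ⟨e3⟩ := Milnor1965_morseComplex_homology_of_free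
    Cobordism.Milnor1965_morseHomology_free_holds hg 2
  have hH3 : IsZero (relativeSingularHomology ℤ ℤ c.W (range c.inl) 3) :=
    (ShortComplex.isZero_homology_of_isZero_X₂ _ hC3).of_iso e3.symm
  -- `H₂(W, V) ↪ C₂`
  obtain ⟨e2⟩ := Milnor1965_morseComplex_homology_of_free
    Cobordism.Milnor1965_morseHomology_free_holds hg 1
  set S := c.morseComplexAt g 1 with hS
  have hf : S.f = 0 := hC3.eq_of_src _ _
  haveI := ShortComplex.isIso_homologyπ S hf
  let j : relativeSingularHomology ℤ ℤ c.W (range c.inl) 2 ⟶ c.morseHomology g 2 2 :=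
    e2.inv ≫ inv (S.homologyπ) ≫ S.iCycles
  have hj : Function.Injective j := by
    have hmono : Mono j := by
      dsimp only [j]
      infer_instance
    exact (ModuleCat.mono_iff_injective j).1 hmono
  obtain ⟨-, hfree2, hfin2, -⟩ := Cobordism.Milnor1965_morseHomology_free_holds hg 2
  exact ⟨hH3, hfree2, hfin2, j.hom, hj⟩

/-- **Functionals on `H₂` of the incoming end extend over the cobordism when all critical points
have index `≤ 2`** (Milnor 1965, Thm. 7.4 + Cor. 3.15, with the exact sequence of the pair
`(W, V)`, Hatcher 2002 Thm. 2.13: `H₃(W, V) = 0` makes `H₂(V) → H₂(W)` injective, and its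
cokernel `⊆ H₂(W, V) ⊆ C₂` is free, so `Hom(H₂(W), ℤ) → Hom(H₂(V), ℤ)` is onto).
[cite: MilnorHCobordism1965, Thm. 7.4 (PDF p. 48)] [cite: HatcherAT2002, Thm. 2.13 ff.] -/
theorem Cobordism.IsNiceMorseFunction.exists_comp_map_subtypeVal_eq_of_morseIndex_le_two
    {c : Cobordism n M N} {g : c.W → ℝ} (hg : c.IsNiceMorseFunction g)
    (h2 : ∀ z ∈ criticalSet (𝓡∂ (n + 1)) g, morseIndex (𝓡∂ (n + 1)) g z ≤ 2)
    (φ : singularHomology ℤ ℤ (range c.inl) 2 →ₗ[ℤ] ℤ) :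
    ∃ ψ : singularHomology ℤ ℤ c.W 2 →ₗ[ℤ] ℤ,
      ψ ∘ₗ (singularHomology.map ℤ ℤ
        (⟨Subtype.val, continuous_subtype_val⟩ : C(range c.inl, c.W)) 2).hom = φ := by
  classical
  obtain ⟨hH3, hfree, hfin, j, hj⟩ := hg.relativeHomology_of_morseIndex_le_two h2
  haveI := hfree
  haveI := hfin
  set ι := (singularHomology.map ℤ ℤ
    (⟨Subtype.val, continuous_subtype_val⟩ : C(range c.inl, c.W)) 2).hom with hι
  set π := (relativeSingularHomology.ofAbsolute ℤ ℤ c.W (range c.inl) 2).hom with hπ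
  have hex : Function.Exact ι π :=
    (ShortComplex.ShortExact.moduleCat_exact_iff_function_exact _).1
      (relativeSingularHomology.exact_map_ofAbsolute ℤ ℤ (range c.inl) 2)
  have hex' : Function.Exact (relativeSingularHomology.δ ℤ ℤ c.W (range c.inl) 2).hom ι :=
    (ShortComplex.ShortExact.moduleCat_exact_iff_function_exact _).1
      (relativeSingularHomology.exact_δ_map ℤ ℤ (range c.inl) 2)
  have h3 : ∀ x : relativeSingularHomology ℤ ℤ c.W (range c.inl) 3, x = 0 := fun x => by
    have h := hH3.eq_of_src (𝟙 _) 0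
    simpa using congrArg
      (fun f : relativeSingularHomology ℤ ℤ c.W (range c.inl) 3 ⟶ _ => f.hom x) h
  have hinj : Function.Injective ι := by
    rw [injective_iff_map_eq_zero]
    intro y hy
    obtain ⟨x, rfl⟩ := (hex' y).1 hy
    rw [h3 x, map_zero]
  -- the cokernel of `ι` embeds into the free f.g. module `C₂`
  exact LinearMap.exists_comp_eq_of_exact_of_injective ι π j hinj hex hj φ

/-- **Cohomology classes on the cobordism with prescribed periods on the incoming end**: under the
same hypothesis, every functional `φ` on `H₂(M; ℤ)` is `x ↦ ⟨S, inl_* x⟩` for some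
`S ∈ H²(W; ℤ)` (previous lemma and the surjectivity of the Kronecker map, Hatcher 2002 Thm. 3.2).
This is Wall's "`h` extends over the added handles to an element of `H²(Y)`" (proof of Thm. 2,
p. 145) in its homological form. [cite: WallJLMS1964, proof of Thm. 2 (p. 145)] [cite: MilnorHCobordism1965, Thm. 7.4 (PDF p. 48)] [cite: HatcherAT2002, §3.1 Thm. 3.2 (p. 195)] -/
theorem Cobordism.IsNiceMorseFunction.exists_kroneckerPairing_map_inl_eq_of_morseIndex_le_two
    {c : Cobordism n M N} {g : c.W → ℝ} (hg : c.IsNiceMorseFunction g)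
    (h2 : ∀ z ∈ criticalSet (𝓡∂ (n + 1)) g, morseIndex (𝓡∂ (n + 1)) g z ≤ 2)
    (φ : singularHomology ℤ ℤ M 2 →ₗ[ℤ] ℤ) :
    ∃ S : singularCohomology ℤ ℤ c.W 2, ∀ x : singularHomology ℤ ℤ M 2,
      kroneckerPairing ℤ ℤ c.W 2 S
        (singularHomology.map ℤ ℤ (⟨c.inl, c.continuous_inl⟩ : C(M, c.W)) 2 x) = φ x := by
  -- transport `φ` to `H₂(inl(M))`
  set e : M ≃ₜ range c.inl := c.isSmoothEmbedding_inl.isEmbedding.toHomeomorph with he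
  set φ' : singularHomology ℤ ℤ (range c.inl) 2 →ₗ[ℤ] ℤ :=
    φ ∘ₗ (singularHomology.map ℤ ℤ (e.symm : C(range c.inl, M)) 2).hom with hφ'
  obtain ⟨ψ, hψ⟩ := hg.exists_comp_map_subtypeVal_eq_of_morseIndex_le_two h2 φ'
  obtain ⟨S, hS⟩ := kroneckerPairing_surjective ℤ c.W 2 ψ
  refine ⟨S, fun x => ?_⟩
  have hinl : (⟨c.inl, c.continuous_inl⟩ : C(M, c.W)) =
      (⟨Subtype.val, continuous_subtype_val⟩ : C(range c.inl, c.W)).comp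
        (e : C(M, range c.inl)) := by
    ext x
    rfl
  rw [hS, hinl, singularHomology.map_comp, ModuleCat.comp_apply]
  have h := LinearMap.congr_fun hψ (singularHomology.map ℤ ℤ (e : C(M, range c.inl)) 2 x)
  rw [LinearMap.comp_apply] at h
  rw [h, hφ', LinearMap.comp_apply, ← ModuleCat.comp_apply, ← singularHomology.map_comp]
  have hee : (e.symm : C(range c.inl, M)).comp (e : C(M, range c.inl)) = ContinuousMap.id M := by
    ext x
    exact e.symm_apply_apply x
  rw [hee, singularHomology.map_id, ModuleCat.id_apply]

/-! ### A simply connected slab above a simply connected level -/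

/-- **A simply connected slab above a simply connected level** (Milnor 1965, Remark 1 after
Thm. 6.4, via Thm. 3.14: the slab `g⁻¹[b, a₁]` deformation retracts onto the level `g⁻¹(b)`
with the left-hand discs of the critical points above `b` attached, cells of dimension `≥ 2`):
for a Morse function `g` on a cobordism, a non-critical value `b ∈ (0, 1)` with simply connected
level above which all critical points have index `≥ 2`, there is a level `a₁ < 1` above all
critical values with `g⁻¹[b, a₁]` a simply connected regular slab.
[cite: MilnorHCobordism1965, Remark 1 after Thm. 6.4 (PDF p. 38), Thm. 3.14 (PDF pp. 19–21)] -/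
theorem Cobordism.IsMorseFunction.exists_isRegularSlab_simplyConnected
    {c : Cobordism n M N} {g : c.W → ℝ} (hg : c.IsMorseFunction g) {b : ℝ} (hb0 : 0 < b)
    (hb1 : b < 1) (hreg : ∀ z ∈ criticalSet (𝓡∂ (n + 1)) g, g z ≠ b)
    (h2 : ∀ z ∈ criticalSet (𝓡∂ (n + 1)) g, b < g z → 2 ≤ morseIndex (𝓡∂ (n + 1)) g z)
    (hlev : IsSimplyConnected (g ⁻¹' {b})) :
    ∃ (a₁ : ℝ) (h₂ : c.IsRegularSlab g b a₁),
      (∀ z ∈ criticalSet (𝓡∂ (n + 1)) g, g z < a₁) ∧ SimplyConnectedSpace (RegularSlab h₂) := by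
  -- a level above all critical values
  obtain ⟨β, hβ, hβf⟩ := hg.exists_pos_forall_isMCriticalPt
  set a₁ : ℝ := max (1 - β) ((b + 1) / 2) with ha₁def
  have hba₁ : b < a₁ := lt_of_lt_of_le (by linarith) (le_max_right _ _)
  have ha₁1 : a₁ < 1 := max_lt (by linarith) (by linarith)
  have hcrit₁ : ∀ z ∈ criticalSet (𝓡∂ (n + 1)) g, g z < a₁ := fun z hz => by
    have h := (hβf z hz).2
    exact lt_of_lt_of_le (by linarith) (le_max_left _ _)
  have hrega₁ : ∀ z ∈ criticalSet (𝓡∂ (n + 1)) g, g z ≠ a₁ := fun z hz h => (hcrit₁ z hz).ne h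
  have h₂ : c.IsRegularSlab g b a₁ := ⟨hg, hb0, hba₁, ha₁1, hreg, hrega₁⟩
  refine ⟨a₁, h₂, hcrit₁, ?_⟩
  -- simple connectivity of the slab, grown from the level
  obtain ⟨ξ, hξ⟩ := Cobordism.Milnor1965_exists_isGradientLike_holds hg
  have hslab := (Cobordism.isSimplyConnected_slab_left
    Cobordism.Milnor1965_deformationRetract_leftHandDiscs_holds
    Cobordism.Milnor1965_leftHandDisc_isDisc_holds hg ξ hξ (a := b) (t := b) (b := a₁)
    hb0.le le_rfl hba₁ ha₁1.le (fun z hz => ⟨hreg z hz, hrega₁ z hz⟩)).1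
    (fun z hz hzI => h2 z hz hzI.1) (by rwa [Icc_self])
  exact hslab

end Morse

/-! ### The homological half of the parity bridge -/

section Main

variable {P X : Type} [TopologicalSpace P] [T2Space P] [SecondCountableTopology P]
  [ChartedSpace (EuclideanSpace ℝ (Fin 4)) P] [IsManifold (𝓡 4) ∞ P] [CompactSpace P]
  [SimplyConnectedSpace P]
  [TopologicalSpace X] [T2Space X] [SecondCountableTopology X]
  [ChartedSpace (EuclideanSpace ℝ (Fin 4)) X] [IsManifold (𝓡 4) ∞ X] [CompactSpace X]
  [SimplyConnectedSpace X]

/-- **Evenness of `Q_X` from an even middle level of a cobordism `P ⇝ X ⊔ X`** (the homological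
half of the parity bridge in the proof of Wall 1964, Thm. 2; see the module docstring for the
proof).  `c : P ⇝ X ⊔ X` is a cobordism of closed smooth 4-manifolds, `P` and `X` simply
connected (`c.W` need not be), `g` a nice Morse function on `c` with all indices `≥ 2`, `e : N → W` an embedding onto
the level `g⁻¹(1/2)`, and every orientation of `N` has even form; then every orientation of `X`
has even form. [cite: WallJLMS1964, proof of Thm. 2 (p. 145)] [cite: MilnorHCobordism1965, Thm. 7.4 (PDF p. 48), Remark 1 after Thm. 6.4 (PDF p. 38)] [cite: Thom1952, Thm V.7 (p. 173)] -/
theorem Cobordism.IsNiceMorseFunction.isEven_intersectionForm_of_level_half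
    {c : Cobordism 4 P (X ⊕ X)} {g : c.W → ℝ}
    (hg : c.IsNiceMorseFunction g)
    (h2 : ∀ z, IsMCriticalPt (𝓡∂ (4 + 1)) g z → 2 ≤ morseIndex (𝓡∂ (4 + 1)) g z)
    {N : Type} [TopologicalSpace N] [T2Space N] [CompactSpace N]
    [ChartedSpace (EuclideanSpace ℝ (Fin 4)) N]
    (e : N → c.W) (he : Topology.IsEmbedding e) (her : range e = g ⁻¹' {2⁻¹})
    (heven : ∀ μN : HomologicalOrientation ℤ N 4, (intersectionForm two_add_two_eq_four μN).IsEven)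
    (μ : HomologicalOrientation ℤ X 4) : (intersectionForm two_add_two_eq_four μ).IsEven := by
  classical
  have hn : (1 : ℕ) ≤ 4 := by norm_num
  have hgM : c.IsMorseFunction g := hg.isMorseFunction
  -- critical values versus the middle level `1/2`
  have hval : ∀ z, IsMCriticalPt (𝓡∂ (4 + 1)) g z →
      (morseIndex (𝓡∂ (4 + 1)) g z = 2 → g z < 2⁻¹) ∧
        (3 ≤ morseIndex (𝓡∂ (4 + 1)) g z → 2⁻¹ < g z) := fun z hz => by
    rw [hg.apply_eq hz, Cobordism.niceLevel_def]
    constructor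
    · intro h
      rw [h]
      norm_num
    · intro h
      have h' : (3 : ℝ) ≤ morseIndex (𝓡∂ (4 + 1)) g z := by exact_mod_cast h
      rw [lt_div_iff₀ (by positivity)]
      push_cast
      linarith
  have hreg : ∀ z ∈ criticalSet (𝓡∂ (4 + 1)) g, g z ≠ 2⁻¹ := fun z hz => by
    have hz' := mem_criticalSet.1 hz
    have h2z := h2 z hz'
    rcases h2z.eq_or_lt with h | h
    · exact ((hval z hz').1 h.symm).ne
    · exact ((hval z hz').2 (by omega)).ne'
  have habove : ∀ z ∈ criticalSet (𝓡∂ (4 + 1)) g, 2⁻¹ < g z →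
      3 ≤ morseIndex (𝓡∂ (4 + 1)) g z := fun z hz hlt => by
    have hz' := mem_criticalSet.1 hz
    have h2z := h2 z hz'
    rcases h2z.eq_or_lt with h | h
    · exact absurd hlt (not_lt.2 ((hval z hz').1 h.symm).le)
    · omega
  have hbelow : ∀ z ∈ criticalSet (𝓡∂ (4 + 1)) g, g z < 2⁻¹ →
      morseIndex (𝓡∂ (4 + 1)) g z = 2 := fun z hz hlt => by
    have hz' := mem_criticalSet.1 hz
    have h2z := h2 z hz'
    rcases h2z.eq_or_lt with h | h
    · exact h.symm
    · exact absurd hlt (not_lt.2 ((hval z hz').2 (by omega)).le)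
  -- the middle level is simply connected (turn the triad about: `P` with 3-cells attached)
  have hlev : IsSimplyConnected (g ⁻¹' {2⁻¹}) := by
    obtain ⟨ξ, hξ⟩ := Cobordism.Milnor1965_exists_isGradientLike_holds (c := c) hgM
    have hg' : c.symm.IsMorseFunction (fun z => 1 - g z) := hgM.symm
    have hξ' : IsGradientLike (𝓡∂ (4 + 1)) (fun z => 1 - g z) (⇑(-ξ)) := by
      rw [ContMDiffSection.coe_neg]
      exact hgM.isGradientLike_const_sub_neg hξ 1
    have hcrit' := hgM.criticalSet_one_sub
    have h := Cobordism.isSimplyConnected_level_of_above (c := c.symm)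
      Cobordism.Milnor1965_deformationRetract_leftHandDiscs_holds
      Cobordism.Milnor1965_leftHandDisc_isDisc_holds hg' (-ξ) hξ'
      (inferInstance : SimplyConnectedSpace P) (b := 1 - 2⁻¹) ⟨by norm_num, by norm_num⟩
      (fun z hz => by
        have hz' : z ∈ criticalSet (𝓡∂ (4 + 1)) (fun y : c.W => 1 - g y) := hz
        rw [hcrit'] at hz'
        intro h
        exact hreg z hz' (by linarith))
      (fun z hz hzb => by
        have hz' : z ∈ criticalSet (𝓡∂ (4 + 1)) (fun y : c.W => 1 - g y) := hz
        rw [hcrit'] at hz'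
        have hsum := hgM.morseIndex_one_sub_add hz'
        have h2z := hbelow z hz' (by linarith)
        change 3 ≤ morseIndex (𝓡∂ (4 + 1)) (fun y : c.W => 1 - g y) z ∧
          morseIndex (𝓡∂ (4 + 1)) (fun y : c.W => 1 - g y) z + 2 ≤ 4 + 1
        omega)
    have hset : (fun z : c.W => 1 - g z) ⁻¹' {1 - 2⁻¹} = g ⁻¹' {2⁻¹} := by
      ext z
      simp only [mem_preimage, mem_singleton_iff, sub_right_inj]
    have h' : IsSimplyConnected ((fun z : c.W => 1 - g z) ⁻¹' {1 - 2⁻¹}) := h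
    rw [hset] at h'
    exact h'
  -- the slab `U = g⁻¹[1/2, a₁]` above the middle level
  obtain ⟨a₁, h₂, hcrit₁, hslab⟩ := hgM.exists_isRegularSlab_simplyConnected (b := 2⁻¹)
    (by norm_num) (by norm_num) hreg (fun z hz _ => h2 z (mem_criticalSet.1 hz)) hlev
  haveI : SimplyConnectedSpace (RegularSlab h₂) := hslab
  haveI : SimplyConnectedSpace (RegularSlab.cobordism h₂).W := hslab
  have hb : IsRegularLevel (𝓡∂ (4 + 1)) g 2⁻¹ := RegularSlab.isRegularLevel_left h₂
  have ha₁ : IsRegularLevel (𝓡∂ (4 + 1)) g a₁ := RegularSlab.isRegularLevel_right h₂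
  haveI : SimplyConnectedSpace (RegularLevel hb) := hlev
  -- the lower end `≅ g⁻¹(1/2) ≅ N`
  let e₂ : RegularLevel hb ≃ₜ RegularSlab.botEnd h₂ := (RegularSlab.botEndDiffeomorph h₂).toHomeomorph
  haveI : SimplyConnectedSpace (RegularSlab.botEnd h₂) :=
    e₂.symm.toHomotopyEquiv.simplyConnectedSpace
  let eN : N ≃ₜ RegularLevel hb := he.toHomeomorph.trans (Homeomorph.setCongr her)
  have hevenBot : ∀ ν : HomologicalOrientation ℤ (RegularSlab.botEnd h₂) 4,
      (intersectionForm two_add_two_eq_four ν).IsEven :=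
    isEven_intersectionForm_of_homeomorph (e₂.symm.trans eN.symm) heven
  have hν : ∀ [SimplyConnectedSpace (RegularSlab.botEnd h₂)],
      Nonempty (HomologicalOrientation ℤ (RegularSlab.botEnd h₂) 4) :=
    nonempty_homologicalOrientation_int_of_simplyConnectedSpace_holds (RegularSlab.botEnd h₂)
  obtain ⟨ν⟩ := hν
  -- the upper end `≅ g⁻¹(a₁) ≅ X ⊔ X`
  have hcs : criticalSet (𝓡∂ (4 + 1)) (fun z => 1 - g z) = criticalSet (𝓡∂ (4 + 1)) g :=
    hgM.criticalSet_one_sub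
  have hset₁ : g ⁻¹' {a₁} = (fun z => 1 - g z) ⁻¹' {1 - a₁} := by
    ext z
    simp only [mem_preimage, mem_singleton_iff, sub_right_inj]
  obtain ⟨φ₂⟩ := hgM.symm.nonempty_diffeomorph_level_of_forall_le (b := 1 - a₁)
    (by linarith [h₂.lt_one]) (by linarith [h₂.pos, h₂.lt])
    (fun z hz => by
      have hz' : z ∈ criticalSet (𝓡∂ (4 + 1)) g := (Set.ext_iff.1 hcs z).1 hz
      linarith [hcrit₁ z hz']) (RegularLevel ha₁)
    (RegularLevel.incl ha₁) (RegularLevel.isSmoothEmbedding_incl ha₁)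
    ((RegularLevel.range_incl ha₁).trans hset₁)
  let f₂ : RegularSlab.topEnd h₂ ≃ₜ X ⊕ X :=
    (RegularSlab.topEndDiffeomorph h₂).toHomeomorph.symm.trans φ₂.toHomeomorph.symm
  -- the slab read from the top carries a nice Morse function with all indices `≤ 2`
  have hfn : (RegularSlab.cobordism h₂).IsMorseFunction (RegularSlab.fn h₂) :=
    RegularSlab.isMorseFunction_fn h₂ hn
  obtain ⟨G, hG, hGcrit, hGidx⟩ := Cobordism.Milnor1965_finalRearrangement_holds hfn.symm
  have hGle : ∀ p ∈ criticalSet (𝓡∂ (4 + 1)) G, morseIndex (𝓡∂ (4 + 1)) G p ≤ 2 := by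
    intro p hp
    rw [hGcrit] at hp
    rw [hGidx p hp]
    have hp' : p ∈ criticalSet (𝓡∂ (4 + 1)) (RegularSlab.fn h₂) :=
      (Set.ext_iff.1 hfn.criticalSet_one_sub p).1 hp
    have hsum : morseIndex (𝓡∂ (4 + 1)) (fun q => 1 - RegularSlab.fn h₂ q) p +
        morseIndex (𝓡∂ (4 + 1)) (RegularSlab.fn h₂) p = 4 + 1 := hfn.morseIndex_one_sub_add hp'
    have hpc : IsMCriticalPt (𝓡∂ (4 + 1)) g (RegularSlab.incl h₂ p) :=
      (RegularSlab.isMCriticalPt_fn_iff h₂ hn p).1 (mem_criticalSet.1 hp')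
    have hidx : morseIndex (𝓡∂ (4 + 1)) (RegularSlab.fn h₂) p =
        morseIndex (𝓡∂ (4 + 1)) g (RegularSlab.incl h₂ p) := RegularSlab.morseIndex_fn_eq h₂ p hpc
    have hIoo := RegularSlab.apply_mem_Ioo_of_isMCriticalPt h₂ p hpc
    have h3 : 3 ≤ morseIndex (𝓡∂ (4 + 1)) g (RegularSlab.incl h₂ p) :=
      habove _ (mem_criticalSet.2 hpc) hIoo.1
    have hfin : morseIndex (𝓡∂ (4 + 1)) (fun q => 1 - RegularSlab.fn h₂ q) p ≤ 2 := by omega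
    exact hfin
  -- the relative fundamental class of the slab and its boundary
  obtain ⟨z, hz⟩ := (RegularSlab.cobordism h₂).exists_isRelFundamentalClass_of_simplyConnectedSpace
  obtain ⟨u, v, hu, hv, hδ⟩ := Cobordism.exists_δ_eq_add_of_isRelFundamentalClass four_ne_zero
    (RegularSlab.cobordism h₂) hz
  obtain ⟨a, b, ha, hb', hv'⟩ := exists_eq_map_add_map_of_isGenerator_toLocal f₂ μ μ v hv
  obtain ⟨p₀⟩ : Nonempty (RegularSlab.botEnd h₂) := inferInstance
  have hu' := eq_fundamentalClass_or_eq_neg_of_isGenerator_toLocal ν u p₀ (hu p₀)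
  -- the class `S` with periods `⟨α, -⟩` on the first copy of `X` and `0` on the second
  intro x
  induction x using freeCohomology.induction_on with
  | h α =>
  obtain ⟨x₀⟩ : Nonempty X := inferInstance
  let r : C(X ⊕ X, X) := ⟨Sum.elim id (fun _ => x₀), continuous_id.sumElim continuous_const⟩
  let φ : singularHomology ℤ ℤ (RegularSlab.topEnd h₂) 2 →ₗ[ℤ] ℤ :=
    kroneckerPairing ℤ ℤ X 2 α ∘ₗ
      (singularHomology.map ℤ ℤ (r.comp (f₂ : C(RegularSlab.topEnd h₂, X ⊕ X))) 2).hom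
  obtain ⟨S, hS⟩ := hG.exists_kroneckerPairing_map_inl_eq_of_morseIndex_le_two hGle φ
  have hS' : ∀ y : singularHomology ℤ ℤ (RegularSlab.topEnd h₂) 2,
      kroneckerPairing ℤ ℤ (RegularSlab.cobordism h₂).W 2 S
        (singularHomology.map ℤ ℤ (⟨(RegularSlab.cobordism h₂).inr,
          (RegularSlab.cobordism h₂).continuous_inr⟩ :
            C(RegularSlab.topEnd h₂, (RegularSlab.cobordism h₂).W)) 2 y) = φ y := hS
  -- the periods of `S` on the two copies of `X`
  have hrA : (r.comp (f₂ : C(RegularSlab.topEnd h₂, X ⊕ X))).comp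
      ((f₂.symm : C(X ⊕ X, RegularSlab.topEnd h₂)).comp (sumInl X X)) = ContinuousMap.id X := by
    ext y
    simp [r]
  have hrB : (r.comp (f₂ : C(RegularSlab.topEnd h₂, X ⊕ X))).comp
      ((f₂.symm : C(X ⊕ X, RegularSlab.topEnd h₂)).comp (sumInr X X)) =
        ContinuousMap.const X x₀ := by
    ext y
    simp [r]
  have hperA : ∀ y : singularHomology ℤ ℤ X 2,
      kroneckerPairing ℤ ℤ X 2 (singularCohomology.map ℤ ℤ
          ((⟨(RegularSlab.cobordism h₂).inr, (RegularSlab.cobordism h₂).continuous_inr⟩ :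
            C(RegularSlab.topEnd h₂, (RegularSlab.cobordism h₂).W)).comp
            ((f₂.symm : C(X ⊕ X, RegularSlab.topEnd h₂)).comp (sumInl X X))) 2 S) y = kroneckerPairing ℤ ℤ X 2 α y := fun y => by
    rw [kroneckerPairing_map, singularHomology.map_comp,
      ModuleCat.comp_apply, hS']
    simp only [φ, LinearMap.comp_apply]
    rw [← ModuleCat.comp_apply, ← singularHomology.map_comp, hrA, singularHomology.map_id,
      ModuleCat.id_apply]
  have hperB : ∀ y : singularHomology ℤ ℤ X 2,
      kroneckerPairing ℤ ℤ X 2 (singularCohomology.map ℤ ℤ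
          ((⟨(RegularSlab.cobordism h₂).inr, (RegularSlab.cobordism h₂).continuous_inr⟩ :
            C(RegularSlab.topEnd h₂, (RegularSlab.cobordism h₂).W)).comp
            ((f₂.symm : C(X ⊕ X, RegularSlab.topEnd h₂)).comp (sumInr X X))) 2 S) y = 0 := fun y => by
    rw [kroneckerPairing_map, singularHomology.map_comp,
      ModuleCat.comp_apply, hS']
    simp only [φ, LinearMap.comp_apply]
    rw [← ModuleCat.comp_apply, ← singularHomology.map_comp, hrB,
      singularHomology.map_const ℤ ℤ x₀ two_ne_zero]
    simp
  have hinjK := (freeKroneckerPairing_two_bijective (X := X)).1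
  have hA : freeCohomology.mk (R := ℤ) (singularCohomology.map ℤ ℤ
          ((⟨(RegularSlab.cobordism h₂).inr, (RegularSlab.cobordism h₂).continuous_inr⟩ :
            C(RegularSlab.topEnd h₂, (RegularSlab.cobordism h₂).W)).comp
            ((f₂.symm : C(X ⊕ X, RegularSlab.topEnd h₂)).comp (sumInl X X))) 2 S) = freeCohomology.mk α := by
    apply hinjK
    ext y
    rw [freeKroneckerPairing_mk, freeKroneckerPairing_mk, hperA]
  have hB : freeCohomology.mk (R := ℤ) (singularCohomology.map ℤ ℤ
          ((⟨(RegularSlab.cobordism h₂).inr, (RegularSlab.cobordism h₂).continuous_inr⟩ :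
            C(RegularSlab.topEnd h₂, (RegularSlab.cobordism h₂).W)).comp
            ((f₂.symm : C(X ⊕ X, RegularSlab.topEnd h₂)).comp (sumInr X X))) 2 S) = 0 := by
    apply hinjK
    ext y
    rw [freeKroneckerPairing_mk, hperB, map_zero, LinearMap.zero_apply]
  -- Thom's isotropy, term by term
  have key := Cobordism.kronecker_cup_inl_add_eq_zero two_add_two_eq_four
    (RegularSlab.cobordism h₂) f₂ hδ hv' S S
  have ht1 : Even (kroneckerPairing ℤ ℤ (RegularSlab.botEnd h₂) 4
      (cupProduct two_add_two_eq_four (singularCohomology.map ℤ ℤ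
          (⟨(RegularSlab.cobordism h₂).inl, (RegularSlab.cobordism h₂).continuous_inl⟩ :
            C(RegularSlab.botEnd h₂, (RegularSlab.cobordism h₂).W)) 2 S) (singularCohomology.map ℤ ℤ
          (⟨(RegularSlab.cobordism h₂).inl, (RegularSlab.cobordism h₂).continuous_inl⟩ :
            C(RegularSlab.botEnd h₂, (RegularSlab.cobordism h₂).W)) 2 S)) u) := by
    have hev := hevenBot ν (freeCohomology.mk (singularCohomology.map ℤ ℤ
          (⟨(RegularSlab.cobordism h₂).inl, (RegularSlab.cobordism h₂).continuous_inl⟩ :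
            C(RegularSlab.botEnd h₂, (RegularSlab.cobordism h₂).W)) 2 S))
    rw [intersectionForm_mk_mk, cupPairing_apply] at hev
    rcases hu' with hu' | hu'
    · rwa [hu']
    · rwa [hu', map_neg, even_neg]
  have ht3 : kroneckerPairing ℤ ℤ X 4 (cupProduct two_add_two_eq_four (singularCohomology.map ℤ ℤ
          ((⟨(RegularSlab.cobordism h₂).inr, (RegularSlab.cobordism h₂).continuous_inr⟩ :
            C(RegularSlab.topEnd h₂, (RegularSlab.cobordism h₂).W)).comp
            ((f₂.symm : C(X ⊕ X, RegularSlab.topEnd h₂)).comp (sumInr X X))) 2 S) (singularCohomology.map ℤ ℤ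
          ((⟨(RegularSlab.cobordism h₂).inr, (RegularSlab.cobordism h₂).continuous_inr⟩ :
            C(RegularSlab.topEnd h₂, (RegularSlab.cobordism h₂).W)).comp
            ((f₂.symm : C(X ⊕ X, RegularSlab.topEnd h₂)).comp (sumInr X X))) 2 S)) b = 0 := by
    have h0 : kroneckerPairing ℤ ℤ X 4 (cupProduct two_add_two_eq_four (singularCohomology.map ℤ ℤ
          ((⟨(RegularSlab.cobordism h₂).inr, (RegularSlab.cobordism h₂).continuous_inr⟩ :
            C(RegularSlab.topEnd h₂, (RegularSlab.cobordism h₂).W)).comp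
            ((f₂.symm : C(X ⊕ X, RegularSlab.topEnd h₂)).comp (sumInr X X))) 2 S) (singularCohomology.map ℤ ℤ
          ((⟨(RegularSlab.cobordism h₂).inr, (RegularSlab.cobordism h₂).continuous_inr⟩ :
            C(RegularSlab.topEnd h₂, (RegularSlab.cobordism h₂).W)).comp
            ((f₂.symm : C(X ⊕ X, RegularSlab.topEnd h₂)).comp (sumInr X X))) 2 S))
        μ.fundamentalClass = 0 := by
      rw [← cupPairing_apply, ← intersectionForm_mk_mk, hB]
      simp only [map_zero]
    rcases hb' with hb' | hb'
    · rw [hb', h0]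
    · rw [hb', map_neg, h0, neg_zero]
  have ht2 : kroneckerPairing ℤ ℤ X 4 (cupProduct two_add_two_eq_four (singularCohomology.map ℤ ℤ
          ((⟨(RegularSlab.cobordism h₂).inr, (RegularSlab.cobordism h₂).continuous_inr⟩ :
            C(RegularSlab.topEnd h₂, (RegularSlab.cobordism h₂).W)).comp
            ((f₂.symm : C(X ⊕ X, RegularSlab.topEnd h₂)).comp (sumInl X X))) 2 S) (singularCohomology.map ℤ ℤ
          ((⟨(RegularSlab.cobordism h₂).inr, (RegularSlab.cobordism h₂).continuous_inr⟩ :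
            C(RegularSlab.topEnd h₂, (RegularSlab.cobordism h₂).W)).comp
            ((f₂.symm : C(X ⊕ X, RegularSlab.topEnd h₂)).comp (sumInl X X))) 2 S)) a =
      intersectionForm two_add_two_eq_four μ (freeCohomology.mk α) (freeCohomology.mk α) ∨
      kroneckerPairing ℤ ℤ X 4 (cupProduct two_add_two_eq_four (singularCohomology.map ℤ ℤ
          ((⟨(RegularSlab.cobordism h₂).inr, (RegularSlab.cobordism h₂).continuous_inr⟩ :
            C(RegularSlab.topEnd h₂, (RegularSlab.cobordism h₂).W)).comp
            ((f₂.symm : C(X ⊕ X, RegularSlab.topEnd h₂)).comp (sumInl X X))) 2 S) (singularCohomology.map ℤ ℤ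
          ((⟨(RegularSlab.cobordism h₂).inr, (RegularSlab.cobordism h₂).continuous_inr⟩ :
            C(RegularSlab.topEnd h₂, (RegularSlab.cobordism h₂).W)).comp
            ((f₂.symm : C(X ⊕ X, RegularSlab.topEnd h₂)).comp (sumInl X X))) 2 S)) a =
        -intersectionForm two_add_two_eq_four μ (freeCohomology.mk α) (freeCohomology.mk α) := by
    have h0 : kroneckerPairing ℤ ℤ X 4 (cupProduct two_add_two_eq_four (singularCohomology.map ℤ ℤ
          ((⟨(RegularSlab.cobordism h₂).inr, (RegularSlab.cobordism h₂).continuous_inr⟩ :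
            C(RegularSlab.topEnd h₂, (RegularSlab.cobordism h₂).W)).comp
            ((f₂.symm : C(X ⊕ X, RegularSlab.topEnd h₂)).comp (sumInl X X))) 2 S) (singularCohomology.map ℤ ℤ
          ((⟨(RegularSlab.cobordism h₂).inr, (RegularSlab.cobordism h₂).continuous_inr⟩ :
            C(RegularSlab.topEnd h₂, (RegularSlab.cobordism h₂).W)).comp
            ((f₂.symm : C(X ⊕ X, RegularSlab.topEnd h₂)).comp (sumInl X X))) 2 S))
        μ.fundamentalClass =
        intersectionForm two_add_two_eq_four μ (freeCohomology.mk α) (freeCohomology.mk α) := by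
      rw [← cupPairing_apply, ← intersectionForm_mk_mk, hA]
    rcases ha with ha | ha
    · left
      rw [ha, h0]
    · right
      rw [ha, map_neg, h0]
  -- conclusion: `Q(α, α) = ∓⟨S|V ⌣ S|V, u⟩`, which is even
  rcases ht2 with ht2 | ht2
  · have : intersectionForm two_add_two_eq_four μ (freeCohomology.mk α) (freeCohomology.mk α) =
        -kroneckerPairing ℤ ℤ (RegularSlab.botEnd h₂) 4
          (cupProduct two_add_two_eq_four (singularCohomology.map ℤ ℤ
          (⟨(RegularSlab.cobordism h₂).inl, (RegularSlab.cobordism h₂).continuous_inl⟩ :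
            C(RegularSlab.botEnd h₂, (RegularSlab.cobordism h₂).W)) 2 S) (singularCohomology.map ℤ ℤ
          (⟨(RegularSlab.cobordism h₂).inl, (RegularSlab.cobordism h₂).continuous_inl⟩ :
            C(RegularSlab.botEnd h₂, (RegularSlab.cobordism h₂).W)) 2 S)) u := by
      linear_combination key - ht2 - ht3
    rw [this, even_neg]
    exact ht1
  · have : intersectionForm two_add_two_eq_four μ (freeCohomology.mk α) (freeCohomology.mk α) =
        kroneckerPairing ℤ ℤ (RegularSlab.botEnd h₂) 4
          (cupProduct two_add_two_eq_four (singularCohomology.map ℤ ℤ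
          (⟨(RegularSlab.cobordism h₂).inl, (RegularSlab.cobordism h₂).continuous_inl⟩ :
            C(RegularSlab.botEnd h₂, (RegularSlab.cobordism h₂).W)) 2 S) (singularCohomology.map ℤ ℤ
          (⟨(RegularSlab.cobordism h₂).inl, (RegularSlab.cobordism h₂).continuous_inl⟩ :
            C(RegularSlab.botEnd h₂, (RegularSlab.cobordism h₂).W)) 2 S)) u := by
      linear_combination -key + ht2 + ht3
    rw [this]
    exact ht1

end Main

end Literature.Topology.FourManifolds

end
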